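import Mathlib.NumberTheory.Padics.HeightOneSpectrum
import Mathlib.NumberTheory.Padics.RingHoms
import Literature.NumberTheory.EllipticCurves.LocalKummerMap
import Literature.NumberTheory.EllipticCurves.HeightFamily
import HarnessLib

/-!
# The kernel of one local restriction on `Sel⁽ⁿ⁾(E/K)` and the bound `#Sel⁽ⁿ⁾ ≤ #𝓛_v · #Z_v`

Topic `NumberTheory/EllipticCurves`; namespace `WeierstrassCurve` (dot notation, as in `Selmer.lean`,
`KummerSelmerStructure.lean`, `LocalKummerMap.lean`). One definition with a body and theorems only:
**no named fact is introduced** (D-0014 / D-0026).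

For a Weierstrass curve `E = W` over a number field `K`, `n : ℤ` and a `K`-field `E` (a completion
`K_v`), `W.selmerResKer n E ≤ Sel⁽ⁿ⁾(E/K)` is the subgroup of Selmer classes whose restriction
`res_E : H¹(K, E[n]) → H¹(Γ_E, E[n])` vanishes — for `E = ℚ_p` this is the group `Z(E)` of
`p`-Selmer elements with trivial image under `res : Sel_p(E) → E(ℚ_p)/pE(ℚ_p) ↪ H¹(ℚ_p, E[p])`
(Bhargava–Skinner, *A positive proportion of elliptic curves over `ℚ` have rank one*, J. Ramanujan
Math. Soc. 29 (2014) = arXiv:1401.0233, Thm. 7 (ii) and the proof of Lemma 16: the Selmer elements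
"that restrict to an element in the image of `E(ℚ_p)[p]`" resp. with trivial restriction), the
object written `Z` in the binders `hker` / `hKim` / `hlocP` of the tree's
`Literature.NumberTheory.EllipticCurves.bsz_rankLeOne_cRank_of_pieces`
(`LeadingTermBSZResCellAssemblyProofs.lean`).

## What is proved

* `res_mem_kummerLocalConditionAt_of_mem_selmerGroup` — a Selmer class restricts into the local
  Kummer condition `𝓛_v` (`KummerSelmerStructure.comap_res_kummerLocalConditionAt`).
* `natCard_selmerGroup_le_natCard_kummerLocalConditionAt_mul` — **`#Sel⁽ⁿ⁾(E/K) ≤ #𝓛_v · #Z_v`**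
  at a finite place `v` (`n ≠ 0`): `Sel⁽ⁿ⁾/Z_v ≅ res_v(Sel⁽ⁿ⁾) ≤ 𝓛_v`, which is finite
  (`LocalKummerMap.finite_kummerLocalConditionAt_adicCompletion`).
* `natCard_selmerGroup_le_mul_mul_natCard_selmerResKer` — the same with
  `#𝓛_v = #E(K_v)[n] · #(𝓞_v/n𝓞_v)` (`LocalKummerMap.natCard_kummerLocalConditionAt_adicCompletion`;
  Milne, *ADT*, I Lemma 3.3 / Silverman VII.6.3; the sentence
  "`#E(ℚ_p)/pE(ℚ_p) = p·#E(ℚ_p)[p]`" of the proof of Bhargava–Skinner's Lemma 16).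
* `torsionBy_eq_bot_of_natCard_ker_nsmul_baseChange_eq_one` — `E(L)[n] = 0 ⟹ E(F)[n] = 0` for a
  field extension `L/F` (`E(F) ↪ E(L)`): the one local input `E(ℚ₅)[5] = 0` of the res-cell also
  gives the global `E(ℚ)[5] = 0` used by the parity / `(cork1)` steps.
* over `ℚ` at the place `v ∋ p`: `natCard_adicCompletionIntegers_quot_span_prime` (`#(ℤ_v/pℤ_v) = p`)
  and **`natCard_selmerGroup_le_prime_mul_of_natCard_torsion_eq_one`**: if `E(ℚ_p)[p] = 0` then
  `#Sel⁽ᵖ⁾(E/ℚ) ≤ p · #Z_p(E)`; in the `(A, B)`-currency of the height family,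
  `natCard_selmerGroup_shortWeierstrass_le_mul` — the SHAPE PER CURVE of the binder `hker` of
  `bsz_rankLeOne_cRank_of_pieces` (`#Sel₅(E_{A,B}) ≤ 5 · #Z(E_{A,B})`), below the one local input
  `E_{A,B}(ℚ₅)[5] = 0` (which holds on the slice `SP′` where that binder is used — the bundle
  `pub-bsdpct`'s Lemma 4.3, not proved here).

Written by the cell lead of `b2b-bsdres` for the BSD-DENSITY SPRINT (cell book
`cells/density/CONVERSION-QUEUE.md`, row Q4 `hker`; the elementary-binders seat D3 served in the
interim). By-name consumers: the instantiation of `Z`, `hker`, `hKim` ((res) ⟸ `#Z = 1`) and `hlocP`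
in the re-keyed assembly `bsz_rankLeOne_cRank_of_facts` (cell book §4).

## References

* [BhargavaSkinner2014] M. Bhargava, C. Skinner, *A positive proportion of elliptic curves over `ℚ`
  have rank one*, J. Ramanujan Math. Soc. 29 (2014) 221–242 = arXiv:1401.0233: Thm. 7 (ii)
  (chunk p0005 L18–40), Lemma 16 and its proof (chunk p0012 L106–130).
* [MilneADT2006] J. S. Milne, *Arithmetic Duality Theorems*, 2nd ed. (2006), I Lemma 3.3, §6 (6.14).
* [SilvermanAEC2009] J. H. Silverman, *The Arithmetic of Elliptic Curves*, 2nd ed. (2009), X.§4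
  (definition of `S⁽ᵐ⁾(E/K)`, diagram (**)), Prop. VII.6.3.
-/

noncomputable section

open scoped Classical

universe u

namespace WeierstrassCurve

open Literature.NumberTheory.EllipticCurves Literature.NumberTheory.GaloisRepresentations Field
  NumberField IsDedekindDomain

/-! ## `Z_E ≤ Sel⁽ⁿ⁾(E/K)`: Selmer classes with trivial restriction at `E` -/

section General

variable {K : Type u} [Field K] [NumberField K] (W : WeierstrassCurve K) (n : ℤ)
variable (E : Type u) [Field E] [Algebra K E]

/-- **The subgroup `Z_E ≤ Sel⁽ⁿ⁾(E/K)` of Selmer classes with trivial restriction at the `K`-field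
`E`** (a completion `K_v`): the kernel of `res_E : H¹(K, E[n]) → H¹(Γ_E, E[n]|_{Γ_E})`
(`galoisCohomology.res`) restricted to `Sel⁽ⁿ⁾(E/K) = selmerGroup W n`. For `K = ℚ`, `E = ℚ_p`,
`n = p` this is the group of `p`-Selmer elements whose image under
`res : Sel_p(E) → E(ℚ_p)/pE(ℚ_p) (↪ H¹(ℚ_p, E[p]))` is trivial — Bhargava–Skinner's count of
"non-identity `5`-Selmer elements" by their restriction at `p` (Thm. 7 (ii); proof of Lemma 16),
the `Z(E)` of the tree's `bsz_rankLeOne_cRank_of_pieces`.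
[cite: BhargavaSkinner2014, Thm 7 (ii) and proof of Lemma 16] -/
def selmerResKer : AddSubgroup (selmerGroup W n) :=
  ((galoisCohomology.res (W.torsionGaloisModule n) E 1).comp (selmerGroup W n).subtype).ker

/-- Membership in `Z_E`: the restriction of the class at `E` vanishes.
[cite: BhargavaSkinner2014, Thm 7 (ii)] -/
theorem mem_selmerResKer_iff (c : selmerGroup W n) :
    c ∈ W.selmerResKer n E ↔
      galoisCohomology.res (W.torsionGaloisModule n) E 1 (c : galH1Torsion W n) = 0 :=
  Iff.rfl

/-- **A Selmer class satisfies the local Kummer condition at every finite place**: for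
`c ∈ Sel⁽ⁿ⁾(E/K)`, `res_v c ∈ 𝓛_{K_v}` (`selmerLocalKer = res⁻¹ 𝓛`,
`comap_res_kummerLocalConditionAt`). Silverman, *AEC*, X.§4; Milne, *ADT*, I.§6 (6.14).
[cite: SilvermanAEC2009, X.§4 (definition of the m-Selmer group)] -/
theorem res_mem_kummerLocalConditionAt_of_mem_selmerGroup (v : HeightOneSpectrum (𝓞 K))
    {c : galH1Torsion W n} (hc : c ∈ selmerGroup W n) :
    galoisCohomology.res (W.torsionGaloisModule n) (v.adicCompletion K) 1 c ∈
      W.kummerLocalConditionAt n (v.adicCompletion K) := by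
  have h : c ∈ selmerLocalKer W (v.adicCompletion K) n := ((mem_selmerGroup_iff W n c).1 hc).1 v
  rw [← W.comap_res_kummerLocalConditionAt n (v.adicCompletion K)] at h
  exact h

/-- **`#Sel⁽ⁿ⁾(E/K) ≤ #𝓛_v · #Z_v`** at a finite place `v` of `K` (`W` elliptic, `n ≠ 0`): the
restriction `res_v` maps `Sel⁽ⁿ⁾(E/K)` into the finite local Kummer condition `𝓛_{K_v}` with kernel
`Z_v`, so `[Sel⁽ⁿ⁾ : Z_v] = #res_v(Sel⁽ⁿ⁾) ≤ #𝓛_{K_v}` and `#Sel⁽ⁿ⁾ = [Sel⁽ⁿ⁾ : Z_v] · #Z_v`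
(Lagrange). (If `Sel⁽ⁿ⁾` were infinite both `Nat.card`s involving it read `0`.) The counting step
behind Bhargava–Skinner's Lemma 16. [cite: BhargavaSkinner2014, proof of Lemma 16]
[cite: MilneADT2006, I §6 (6.14)] -/
theorem natCard_selmerGroup_le_natCard_kummerLocalConditionAt_mul [W.IsElliptic]
    (v : HeightOneSpectrum (𝓞 K)) {n : ℕ} (hn : n ≠ 0) :
    Nat.card (selmerGroup W n) ≤
      Nat.card (W.kummerLocalConditionAt (n : ℤ) (v.adicCompletion K)) *
        Nat.card (W.selmerResKer (n : ℤ) (v.adicCompletion K)) := by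
  haveI := W.finite_kummerLocalConditionAt_adicCompletion v hn
  set φ : selmerGroup W (n : ℤ) →+ _ :=
    (galoisCohomology.res (W.torsionGaloisModule n) (v.adicCompletion K) 1).comp
      (selmerGroup W (n : ℤ)).subtype with hφ
  have hker : W.selmerResKer (n : ℤ) (v.adicCompletion K) = φ.ker := rfl
  rw [hker, AddSubgroup.card_eq_card_quotient_mul_card_addSubgroup φ.ker,
    Nat.card_congr (QuotientAddGroup.quotientKerEquivRange φ).toEquiv]
  refine Nat.mul_le_mul_right _ ?_
  refine Nat.card_le_card_of_injective
    (fun x : φ.range => (⟨(x : _), ?_⟩ : W.kummerLocalConditionAt (n : ℤ) (v.adicCompletion K)))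
    ?_
  · obtain ⟨c, hc⟩ := x.2
    rw [← hc]
    exact W.res_mem_kummerLocalConditionAt_of_mem_selmerGroup (n : ℤ) v c.2
  · intro x y hxy
    have h := congrArg Subtype.val hxy
    dsimp only at h
    exact Subtype.ext h

/-- **`#Sel⁽ⁿ⁾(E/K) ≤ #E(K_v)[n] · #(𝓞_v/n𝓞_v) · #Z_v`**: the previous bound with the order of the
local Kummer condition `#𝓛_{K_v} = #E(K_v)[n] · #(𝓞_v/n𝓞_v)`
(`natCard_kummerLocalConditionAt_adicCompletion`: the local Kummer sequence and the structure of
`E(K_v)`, Milne I Lemma 3.3 / Silverman VII.6.3 — the identity "`#E(ℚ_p)/pE(ℚ_p) = p·#E(ℚ_p)[p]`"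
of the proof of Bhargava–Skinner's Lemma 16). Here `E(K_v)` is Mathlib's group of `K_v`-points of
`W⁄K_v`. [cite: BhargavaSkinner2014, proof of Lemma 16] [cite: MilneADT2006, I Lemma 3.3] -/
theorem natCard_selmerGroup_le_mul_mul_natCard_selmerResKer [W.IsElliptic]
    (v : HeightOneSpectrum (𝓞 K)) {n : ℕ} (hn : n ≠ 0) :
    Nat.card (selmerGroup W n) ≤
      Nat.card (nsmulAddMonoidHom n :
          (W.baseChange (v.adicCompletion K)).toAffine.Point →+ _).ker *
        Nat.card (v.adicCompletionIntegers K ⧸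
          Ideal.span {(n : v.adicCompletionIntegers K)}) *
        Nat.card (W.selmerResKer (n : ℤ) (v.adicCompletion K)) := by
  rw [← W.natCard_kummerLocalConditionAt_adicCompletion v hn]
  exact W.natCard_selmerGroup_le_natCard_kummerLocalConditionAt_mul v hn

end General

/-! ## `E(K)[n] ↪ E(L)[n]`: trivial local `n`-torsion forces trivial global `n`-torsion -/

section Torsion

variable {F : Type u} [Field F] (W : WeierstrassCurve F) (L : Type u) [Field L] [Algebra F L]

/-- **`E(L)[n] = 0 ⟹ E(F)[n] = 0` for a field extension `L/F`** (e.g. `L = K_v`): the group of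
`F`-points embeds in the group of `L`-points (Mathlib `Affine.Point.map_injective`), `n`-torsion
into `n`-torsion. In the res-cell bookkeeping this is the remark "`E(ℚ)[5] = 0`, as
`E(ℚ)[5] ⊂ E(ℚ₅)[5]`" turning the one local input `E(ℚ₅)[5] = 0` into the global hypothesis
`t₅(E) = 0` of the parity and `(cork1)` steps. Silverman, *AEC*, VII.§3 (proof of Prop. VII.3.1:
`E(K)[m] ⊆ E(K_v)[m]`). [cite: SilvermanAEC2009, VII.§3 (proof of Prop. VII.3.1)] -/
theorem torsionBy_eq_bot_of_natCard_ker_nsmul_baseChange_eq_one {n : ℕ}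
    (h : Nat.card (nsmulAddMonoidHom n : (W.baseChange L).toAffine.Point →+ _).ker = 1) :
    AddSubgroup.torsionBy W.toAffine.Point (n : ℤ) = ⊥ := by
  rw [AddSubgroup.card_eq_one] at h
  set ι : W.toAffine.Point →+ (W.baseChange L).toAffine.Point :=
    Affine.Point.baseChange (W' := W) F L with hι
  have hinj : Function.Injective ι := Affine.Point.map_injective (W' := W) _
  refine (AddSubgroup.eq_bot_iff_forall _).2 fun P hP => hinj ?_
  rw [map_zero]
  have hP' : (n : ℤ) • P = 0 := by
    simpa only [AddSubgroup.torsionBy, Submodule.mem_toAddSubgroup, Submodule.mem_torsionBy_iff]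
      using hP
  have hmem : ι P ∈ (nsmulAddMonoidHom n : (W.baseChange L).toAffine.Point →+ _).ker := by
    rw [AddMonoidHom.mem_ker, nsmulAddMonoidHom_apply, ← map_nsmul, ← natCast_zsmul, hP',
      map_zero]
  rw [h] at hmem
  exact (AddSubgroup.mem_bot).1 hmem

/-- The same in cardinality currency: `#E(L)[n] = 1 ⟹ #E(F)[n] = 1`.
[cite: SilvermanAEC2009, VII.§3 (proof of Prop. VII.3.1)] -/
theorem natCard_torsionBy_eq_one_of_natCard_ker_nsmul_baseChange_eq_one {n : ℕ}
    (h : Nat.card (nsmulAddMonoidHom n : (W.baseChange L).toAffine.Point →+ _).ker = 1) :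
    Nat.card (AddSubgroup.torsionBy W.toAffine.Point (n : ℤ)) = 1 := by
  rw [W.torsionBy_eq_bot_of_natCard_ker_nsmul_baseChange_eq_one L h]
  exact AddSubgroup.card_bot

end Torsion

/-! ## Over `ℚ` at the place above `p` -/

section Rat

open Rat.HeightOneSpectrum

variable {p : ℕ} [hp : Fact p.Prime] {v : HeightOneSpectrum (𝓞 ℚ)}

/-- A finite place `v` of `ℚ` containing the rational prime `p` is the place of `p`
(`primesEquiv v = p`; Mathlib's `natGenerator v`, a prime, divides `p`). [folklore] -/
private theorem primesEquiv_eq_of_natCast_mem_aux (hpv : (p : 𝓞 ℚ) ∈ v.asIdeal) :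
    (primesEquiv v : ℕ) = p := by
  have h : natGenerator v ∣ p := by
    rw [natGenerator_dvd_iff, ← map_natCast (Rat.IsIntegralClosure.intEquiv (𝓞 ℚ)) p]
    exact Ideal.mem_map_of_mem _ hpv
  exact (Nat.prime_dvd_prime_iff_eq (prime_natGenerator v) hp.out).mp h

/-- `p` is a uniformiser of `ℤ_v` for the place `v ∋ p` of `ℚ` (transport of
`PadicInt.irreducible_p` along Mathlib's `padicIntEquiv v : ℤ_v ≃ ℤ_[p]`). [folklore] -/
private theorem irreducible_natCast_adicCompletionIntegers_aux (hpv : (p : 𝓞 ℚ) ∈ v.asIdeal) :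
    Irreducible ((p : ℕ) : v.adicCompletionIntegers ℚ) := by
  haveI := Fact.mk (primesEquiv v).2
  have hq : ((primesEquiv v : Nat.Primes) : ℕ) = p := primesEquiv_eq_of_natCast_mem_aux hpv
  have key : ∀ (q : ℕ) (_ : Fact q.Prime), q = p → Irreducible ((p : ℕ) : ℤ_[q]) := by
    rintro q hq' rfl
    exact PadicInt.irreducible_p
  have h := key _ (Fact.mk (primesEquiv v).2) hq
  rw [← map_natCast (adicCompletionIntegers.padicIntEquiv v) p] at h
  exact (MulEquiv.irreducible_iff (adicCompletionIntegers.padicIntEquiv v)).mp h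

/-- **`#(ℤ_v / pℤ_v) = p` at the place `v ∋ p` of `ℚ`**: `p` is a uniformiser of `ℤ_v ≅ ℤ_p`, so
`pℤ_v` is the maximal ideal and the quotient is the residue field `ℤ_[p]/pℤ_[p] ≅ ℤ/p`
(Mathlib's `padicIntEquiv`, `PadicInt.residueField`). The factor `#(𝓞_v/p𝓞_v)` of
`#𝓛_v = #E(K_v)[p] · #(𝓞_v/p𝓞_v)` for `K = ℚ` — whence "`#E(ℚ_p)/pE(ℚ_p) = p·#E(ℚ_p)[p]`" in the
proof of Bhargava–Skinner's Lemma 16. (Literature-side home of the statement the summit cone proves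
as `Summit.BirchSwinnertonDyer.Rank1Residual.Additive.GoodModelLine.natCard_adicCompletionIntegers_quot_span_eq`,
which a `Literature/` file may not import; same argument.) [cite: BhargavaSkinner2014, proof of Lemma 16]
[cite: MilneADT2006, I Lemma 3.3] -/
theorem natCard_adicCompletionIntegers_quot_span_prime (hpv : (p : 𝓞 ℚ) ∈ v.asIdeal) :
    Nat.card (v.adicCompletionIntegers ℚ ⧸
      Ideal.span {((p : ℕ) : v.adicCompletionIntegers ℚ)}) = p := by
  haveI := Fact.mk (primesEquiv v).2
  have hmax : IsLocalRing.maximalIdeal (v.adicCompletionIntegers ℚ) =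
      Ideal.span {((p : ℕ) : v.adicCompletionIntegers ℚ)} :=
    (IsDiscreteValuationRing.irreducible_iff_uniformizer _).mp
      (irreducible_natCast_adicCompletionIntegers_aux hpv)
  rw [← hmax]
  change Nat.card (IsLocalRing.ResidueField (v.adicCompletionIntegers ℚ)) = p
  rw [Nat.card_congr ((IsLocalRing.ResidueField.mapEquiv
      (adicCompletionIntegers.padicIntEquiv v).toAlgEquiv.toRingEquiv).trans
      (PadicInt.residueField (p := (primesEquiv v : ℕ)))).toEquiv, Nat.card_zmod,
    primesEquiv_eq_of_natCast_mem_aux hpv]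

variable (W : WeierstrassCurve ℚ) [W.IsElliptic]

/-- **`#Sel⁽ᵖ⁾(E/ℚ) ≤ p · #E(ℚ_p)[p] · #Z_p(E)`** for an elliptic curve `E/ℚ`, a prime `p` and the
place `v ∋ p` (`ℚ_v = ℚ_p`): `natCard_selmerGroup_le_mul_mul_natCard_selmerResKer` with
`#(ℤ_v/pℤ_v) = p`. [cite: BhargavaSkinner2014, proof of Lemma 16] [cite: MilneADT2006, I Lemma 3.3] -/
theorem natCard_selmerGroup_le_prime_mul_natCard_torsion_mul (hpv : (p : 𝓞 ℚ) ∈ v.asIdeal) :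
    Nat.card (selmerGroup W p) ≤
      p * Nat.card (nsmulAddMonoidHom p :
          (W.baseChange (v.adicCompletion ℚ)).toAffine.Point →+ _).ker *
        Nat.card (W.selmerResKer (p : ℤ) (v.adicCompletion ℚ)) := by
  have h := W.natCard_selmerGroup_le_mul_mul_natCard_selmerResKer v hp.out.ne_zero
  rw [natCard_adicCompletionIntegers_quot_span_prime hpv] at h
  simpa only [mul_comm p] using h

/-- **`E(ℚ_p)[p] = 0 ⟹ #Sel⁽ᵖ⁾(E/ℚ) ≤ p · #Z_p(E)`** — the shape per curve of the binder `hker`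
of `bsz_rankLeOne_cRank_of_pieces` (there `p = 5`, `Z = Z_5(E)`, on the slice `P = SP′` of curves
with `E(ℚ₅)[5] = 0`). [cite: BhargavaSkinner2014, Thm 7 (ii) and proof of Lemma 16]
[cite: MilneADT2006, I Lemma 3.3] -/
theorem natCard_selmerGroup_le_prime_mul_of_natCard_torsion_eq_one (hpv : (p : 𝓞 ℚ) ∈ v.asIdeal)
    (htors : Nat.card (nsmulAddMonoidHom p :
      (W.baseChange (v.adicCompletion ℚ)).toAffine.Point →+ _).ker = 1) :
    Nat.card (selmerGroup W p) ≤ p * Nat.card (W.selmerResKer (p : ℤ) (v.adicCompletion ℚ)) := by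
  have h := W.natCard_selmerGroup_le_prime_mul_natCard_torsion_mul hpv
  rwa [htors, mul_one] at h

end Rat

end WeierstrassCurve

/-! ## The `(A, B)`-currency of the height family -/

namespace Literature.NumberTheory.EllipticCurves

open WeierstrassCurve NumberField IsDedekindDomain

/-- **The binder `hker` per curve**: for `E_{A,B}` in the height family, a prime `p`, the place
`v ∋ p` of `ℚ`, and `Z(E_{A,B}) := Z_v(E_{A,B})` (`selmerResKer`, the `p`-Selmer classes with
trivial restriction at `p`), if `E_{A,B}(ℚ_p)[p] = 0` then `#Sel_p(E_{A,B}) ≤ p · #Z(E_{A,B})` — at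
`p = 5` literally the conclusion of the binder `hker` of `bsz_rankLeOne_cRank_of_pieces` for this
`Z`. [cite: BhargavaSkinner2014, Thm 7 (ii) and proof of Lemma 16] [cite: MilneADT2006, I Lemma 3.3] -/
theorem natCard_selmerGroup_shortWeierstrass_le_mul {AB : ℤ × ℤ} (hAB : IsInHeightFamily AB)
    {p : ℕ} [Fact p.Prime] {v : HeightOneSpectrum (𝓞 ℚ)} (hpv : (p : 𝓞 ℚ) ∈ v.asIdeal)
    (htors : Nat.card (nsmulAddMonoidHom p :
      ((shortWeierstrass AB).baseChange (v.adicCompletion ℚ)).toAffine.Point →+ _).ker = 1) :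
    Nat.card ((shortWeierstrass AB).selmerGroup p) ≤
      p * Nat.card ((shortWeierstrass AB).selmerResKer (p : ℤ) (v.adicCompletion ℚ)) := by
  haveI := isElliptic_shortWeierstrass hAB
  exact (shortWeierstrass AB).natCard_selmerGroup_le_prime_mul_of_natCard_torsion_eq_one hpv htors

end Literature.NumberTheory.EllipticCurves

end
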